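import Literature.NumberTheory.GaloisRepresentations.LubinTateColemanRelativeExactTwo
import HarnessLib

/-!
# Base change `E₁ ≤ E₂` of the relative Coleman theory at `q = 2`: `𝒰(E₁·K_π^∞) → 𝒰(E₂·K_π^∞)`,
# `g_{ιβ} = ι(g_β)`, `δ(ιβ) = ι(δβ)`, `r_{ιβ} = ι(r_β)`, and the relative norms commute with the inclusions

De Shalit, *Iwasawa theory of elliptic curves with complex multiplication* (1987), Ch. I §2.2–2.3 and III §1.3 (the two-variable
tower is the union of the towers `k'(W_f)` over the finite unramified layers `k'`): for finite Galois `E₁ ≤ E₂ ⊆ F^{nr}` over `F`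
(`|𝓀_F| = 2`, `f = πX + X²`, Frobenius `φ_{E_i}` of `𝒪_{E_i}` — restrictions of one `σ₀ ∈ Γ_F`) the relative Coleman theory of
`LubinTateColemanRelativeSeriesTwo` / `…CoordTwo` / `…ExactTwo` is functorial in the base:

* `map_inclUnitBall_frobUnitBall_symm_iterate` — `ι ∘ (φ_{E₁}⁻¹)^k = (φ_{E₂}⁻¹)^k ∘ ι` on `𝒪_{E₁}⟦X⟧`;
* `RelNormCoherentUnits.baseChange` — **`ιβ ∈ 𝒰(E₂·K_π^∞)` for `β ∈ 𝒰(E₁·K_π^∞)`** (defined as `ofSeries (ι g_β)`), with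
  ★ `coe_val_baseChange` (**its components ARE `β_m` read in `E₂·K_π^{m+1}`**) and ★ `relColemanSeries_baseChange` (**`g_{ιβ} = ι g_β`**);
* ★ `towerNorm_inclusion_val` — **`N_{E₂K_π^{m+1}/E₂K_π^{n+1}}(ι β_m) = ι β_n`**: the relative norms of the two towers are compatible with
  the inclusions (a COROLLARY of the series description, no Galois counting needed);
* `relLogDerivSeries_baseChange` (`δ(ιβ) = ι(δβ)`), `relTildeSeries_baseChange`, ★ `relUnitCoordTwo_baseChange` (**`r_{ιβ} = ι(r_β)`**):
  the coordinates of Theorem I.3.7 are compatible with enlarging the unramified base — the maps along which the two-variable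
  structure over `K(E[𝔭^∞𝔭̄^∞])_v = ⋃_{k'} k'(W_f)` is assembled (III §1.3).

Everything PROVED (0 sorry).

## References

* E. de Shalit, *Iwasawa theory of elliptic curves with complex multiplication* (1987), Ch. I §2.2–2.3, §3.7; Ch. III §1.3. [deShalit1987]
-/

noncomputable section

open scoped PowerSeries.WithPiTopology

namespace Literature.NumberTheory.GaloisRepresentations

section RelativeBaseChangeTwo

open GaloisRepresentations.IsNonarchimedeanLocalField LubinTate ValuativeRel Field

variable {F : Type} [Field F] [ValuativeRel F] [TopologicalSpace F] [IsNonarchimedeanLocalField F]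

attribute [local instance] ltNormUniformSpace ltNormIsUniformAddGroup rk1 nF nE fintypeResidueField

variable {π : 𝒪[F]} (hπ : (valuation F).IsUniformizer (π : F))
variable {E₁ E₂ : IntermediateField F (AlgebraicClosure F)} [FiniteDimensional F E₁] [FiniteDimensional F E₂]
  [Normal F E₁] [Normal F E₂]

/-! ### `ι` intertwines the inverse Frobenii -/

/-- **`ι ∘ φ_{E₁}⁻¹ = φ_{E₂}⁻¹ ∘ ι`** coefficientwise on `𝒪_{E₁}⟦X⟧`, and the same for iterates. [cite: deShalit1987, Ch. I §1.1] -/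
theorem map_inclUnitBall_frobUnitBall_symm_iterate (h : E₁ ≤ E₂) (σ₀ : absoluteGaloisGroup F) (k : ℕ) (G : PowerSeries (unitBall E₁)) :
    PowerSeries.map (inclUnitBall (F := F) h : unitBall E₁ →+* unitBall E₂)
        ((PowerSeries.map ((frobUnitBall E₁ σ₀).symm : unitBall E₁ →+* unitBall E₁))^[k] G) =
      (PowerSeries.map ((frobUnitBall E₂ σ₀).symm : unitBall E₂ →+* unitBall E₂))^[k]
        (PowerSeries.map (inclUnitBall (F := F) h : unitBall E₁ →+* unitBall E₂) G) := by
  induction k generalizing G with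
  | zero => rfl
  | succ k ih =>
    rw [Function.iterate_succ_apply', Function.iterate_succ_apply', ← ih]
    -- one step: `ι (φ₁⁻¹ W) = φ₂⁻¹ (ι W)` from `ι (φ₁ V) = φ₂ (ι V)` with `V = φ₁⁻¹ W`
    have h1 := map_inclUnitBall_map_unitBallEquiv_restrictNormal h σ₀
      (PowerSeries.map ((frobUnitBall E₁ σ₀).symm : unitBall E₁ →+* unitBall E₁)
        ((PowerSeries.map ((frobUnitBall E₁ σ₀).symm : unitBall E₁ →+* unitBall E₁))^[k] G))
    have h2 := map_symm_map E₁ (frobUnitBall E₁ σ₀).symm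
      ((PowerSeries.map ((frobUnitBall E₁ σ₀).symm : unitBall E₁ →+* unitBall E₁))^[k] G)
    rw [RingEquiv.symm_symm] at h2
    change PowerSeries.map _ (PowerSeries.map (frobUnitBall E₁ σ₀ : unitBall E₁ →+* unitBall E₁) _) =
      PowerSeries.map (frobUnitBall E₂ σ₀ : unitBall E₂ →+* unitBall E₂) _ at h1
    rw [h2] at h1
    rw [h1, map_symm_map]

/-- Composition of inclusions of valuation rings. [folklore] -/
private theorem inclUnitBall_comp_inclUnitBall {E E' E'' : IntermediateField F (AlgebraicClosure F)} [FiniteDimensional F E]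
    [FiniteDimensional F E'] [FiniteDimensional F E''] (h : E ≤ E') (h' : E' ≤ E'') :
    (inclUnitBall (F := F) h' : unitBall E' →+* unitBall E'').comp (inclUnitBall (F := F) h : unitBall E →+* unitBall E') =
      (inclUnitBall (F := F) (h.trans h') : unitBall E →+* unitBall E'') :=
  RingHom.ext fun _ => Subtype.ext (Subtype.ext rfl)

/-! ### Base change of norm-coherent units -/

variable [IsGalois F E₁] [IsGalois F E₂] (hq : residueFieldCard F = 2) (h : E₁ ≤ E₂) (hE₂ : E₂ ≤ maxUnramified F)
  {σ₀ : absoluteGaloisGroup F} (hσ₀ : IsAbsArithFrob σ₀)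

/-- **Base change `𝒰(E₁·K_π^∞) → 𝒰(E₂·K_π^∞)`**: the norm-coherent unit over `E₂` whose Coleman series is `ι g_β` — by
`coe_val_baseChange` its components are the `β_m` read in `E₂·K_π^{m+1}`. [cite: deShalit1987, Ch. I §2.2 Theorem; Ch. III §1.3] -/
def RelNormCoherentUnits.baseChange (β : RelNormCoherentUnits hπ E₁) : RelNormCoherentUnits hπ E₂ :=
  RelNormCoherentUnits.ofSeries hπ E₂ hq hE₂
    (PowerSeries.map (inclUnitBall (F := F) h : unitBall E₁ →+* unitBall E₂) (relColemanSeries hπ E₁ hq (h.trans hE₂) hσ₀ β))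
    (relNormTwo_map_inclUnitBall_eq_map_frobenius hπ hq h σ₀ (relNormTwo_relColemanSeries hπ E₁ hq (h.trans hE₂) hσ₀ β))
    (by
      rw [← PowerSeries.coeff_zero_eq_constantCoeff_apply, PowerSeries.coeff_map, PowerSeries.coeff_zero_eq_constantCoeff_apply]
      exact (isUnit_constantCoeff_relColemanSeries hπ E₁ hq (h.trans hE₂) hσ₀ β).map _)

/-- ★ **`g_{ιβ} = ι g_β`.** [cite: deShalit1987, Ch. I §2.2 Theorem] -/
theorem relColemanSeries_baseChange (β : RelNormCoherentUnits hπ E₁) :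
    relColemanSeries hπ E₂ hq hE₂ hσ₀ (β.baseChange hπ hq h hE₂ hσ₀) =
      PowerSeries.map (inclUnitBall (F := F) h : unitBall E₁ →+* unitBall E₂) (relColemanSeries hπ E₁ hq (h.trans hE₂) hσ₀ β) :=
  relColemanSeries_ofSeries hπ E₂ hq hE₂ hσ₀ _ _ _

set_option maxHeartbeats 800000 in
/-- ★ **The components of `ιβ` are the `β_m`**: `(ιβ)_m = ι'(β_m)` in `E₂·K_π^{m+1}` (`ι' : E₁·K_π^{m+1} → E₂·K_π^{m+1}`), since
`((φ₂⁻¹)^{m+1} ι g_β)^{ι₂}(ω_{m+1}) = ι'(((φ₁⁻¹)^{m+1} g_β)^{ι₁}(ω_{m+1})) = ι'(β_m)`. [cite: deShalit1987, Ch. I §2.2 Theorem] -/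
theorem RelNormCoherentUnits.coe_val_baseChange (β : RelNormCoherentUnits hπ E₁) (m : ℕ) :
    (((β.baseChange hπ hq h hE₂ hσ₀).val m : unitBall (E₂ ⊔ ltField π m : IntermediateField F (AlgebraicClosure F))) :
        (E₂ ⊔ ltField π m : IntermediateField F (AlgebraicClosure F))) =
      IntermediateField.inclusion (sup_le_sup_right h (ltField π m))
        ((β.val m : unitBall (E₁ ⊔ ltField π m : IntermediateField F (AlgebraicClosure F))) :
          (E₁ ⊔ ltField π m : IntermediateField F (AlgebraicClosure F))) := by
  have hv : (β.baseChange hπ hq h hE₂ hσ₀).val m =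
      evS (maxNilIdeal F (E₂ ⊔ ltField π m : IntermediateField F (AlgebraicClosure F)))
        (inclPt (le_sup_right : ltField π m ≤ E₂ ⊔ ltField π m) (cohPt hπ m))
        (PowerSeries.map (inclUnitBall (F := F) (le_sup_left : E₂ ≤ E₂ ⊔ ltField π m) :
          unitBall E₂ →+* unitBall (E₂ ⊔ ltField π m : IntermediateField F (AlgebraicClosure F)))
          ((PowerSeries.map ((frobUnitBall E₂ σ₀).symm : unitBall E₂ →+* unitBall E₂))^[m + 1]
            (PowerSeries.map (inclUnitBall (F := F) h : unitBall E₁ →+* unitBall E₂)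
              (relColemanSeries hπ E₁ hq (h.trans hE₂) hσ₀ β)))) := rfl
  have hpt : inclPt (sup_le_sup_right h (ltField π m))
      (inclPt (le_sup_right : ltField π m ≤ E₁ ⊔ ltField π m) (cohPt hπ m)) =
      inclPt (le_sup_right : ltField π m ≤ E₂ ⊔ ltField π m) (cohPt hπ m) := inclPt_inclPt _ _ _
  rw [hv, ← map_inclUnitBall_frobUnitBall_symm_iterate h σ₀, ← RingHom.comp_apply (PowerSeries.map _) (PowerSeries.map _),
    ← PowerSeries.map_comp, inclUnitBall_comp_inclUnitBall, ← hpt,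
    ← inclUnitBall_evS_map E₁ (le_sup_left : E₁ ≤ E₁ ⊔ ltField π m)
      (h.trans (le_sup_left : E₂ ≤ E₂ ⊔ ltField π m)) (sup_le_sup_right h (ltField π m)),
    evS_relColemanSeries hπ E₁ hq (h.trans hE₂) hσ₀ β m]
  rfl

include hq hE₂ hσ₀ in
/-- ★ **The relative norms commute with the inclusions of the towers**: `N_{E₂K_π^{m+1}/E₂K_π^{n+1}}(ι β_m) = ι β_n` for every
`β ∈ 𝒰(E₁·K_π^∞)` (the norm-coherence of `ιβ`). [cite: deShalit1987, Ch. III §1.3] -/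
theorem towerNorm_inclusion_val (β : RelNormCoherentUnits hπ E₁) {n m : ℕ} (hnm : n ≤ m) :
    @Algebra.norm (E₂ ⊔ ltField π n : IntermediateField F (AlgebraicClosure F))
        (E₂ ⊔ ltField π m : IntermediateField F (AlgebraicClosure F)) _ _
        (towerAlgebra (sup_le_sup_left (ltField_mono hπ hnm) E₂))
        (IntermediateField.inclusion (sup_le_sup_right h (ltField π m))
          ((β.val m : unitBall (E₁ ⊔ ltField π m : IntermediateField F (AlgebraicClosure F))) :
            (E₁ ⊔ ltField π m : IntermediateField F (AlgebraicClosure F)))) =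
      IntermediateField.inclusion (sup_le_sup_right h (ltField π n))
        ((β.val n : unitBall (E₁ ⊔ ltField π n : IntermediateField F (AlgebraicClosure F))) :
          (E₁ ⊔ ltField π n : IntermediateField F (AlgebraicClosure F))) := by
  rw [← RelNormCoherentUnits.coe_val_baseChange hπ hq h hE₂ hσ₀ β m, ← RelNormCoherentUnits.coe_val_baseChange hπ hq h hE₂ hσ₀ β n]
  exact (β.baseChange hπ hq h hE₂ hσ₀).coherent n m hnm

/-! ### `δ`, `~`, and the coordinates under base change -/

/-- **`δ(ιβ) = ι(δβ)`.** [cite: deShalit1987, Ch. I §3.4] -/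
theorem relLogDerivSeries_baseChange (β : RelNormCoherentUnits hπ E₁) :
    relLogDerivSeries hπ E₂ hq hE₂ hσ₀ (β.baseChange hπ hq h hE₂ hσ₀) =
      PowerSeries.map (inclUnitBall (F := F) h : unitBall E₁ →+* unitBall E₂) (relLogDerivSeries hπ E₁ hq (h.trans hE₂) hσ₀ β) := by
  rw [relLogDerivSeries, relLogDerivSeries,
    ← relLogDeriv_map hπ (ψ := (inclUnitBall (F := F) h : unitBall E₁ →+* unitBall E₂)) (fun a => (inclUnitBall (F := F) h).commutes a)]
  congr 1
  exact Units.ext (by rw [IsUnit.unit_spec, Units.coe_map, IsUnit.unit_spec, relColemanSeries_baseChange]; rfl)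

/-- **`(δ(ιβ))~ = ι((δβ)~)`.** [cite: deShalit1987, Ch. I §3.13] -/
theorem relTildeSeries_baseChange (u : LTCoeff F) (β : RelNormCoherentUnits hπ E₁) :
    relTildeSeries hπ E₂ hq hE₂ hσ₀ u (β.baseChange hπ hq h hE₂ hσ₀) =
      PowerSeries.map (inclUnitBall (F := F) h : unitBall E₁ →+* unitBall E₂) (relTildeSeries hπ E₁ hq (h.trans hE₂) hσ₀ u β) := by
  have hcu : (inclUnitBall (F := F) h : unitBall E₁ →+* unitBall E₂) (algebraMap (LTCoeff F) (unitBall E₁) u) =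
      algebraMap (LTCoeff F) (unitBall E₂) u := (inclUnitBall (F := F) h).commutes u
  rw [relTildeSeries, relTildeSeries, relLogDerivSeries_baseChange, map_sub (PowerSeries.map (inclUnitBall (F := F) h : unitBall E₁ →+* unitBall E₂)),
    map_mul (PowerSeries.map (inclUnitBall (F := F) h : unitBall E₁ →+* unitBall E₂)), PowerSeries.map_C, hcu,
    ringHom_map_subst_map_ltSer (ψ := (inclUnitBall (F := F) h : unitBall E₁ →+* unitBall E₂)) (inclUnitBall_algebraMap_pi h π)]
  change _ = _ - _ * PowerSeries.subst _ (PowerSeries.map _ (PowerSeries.map (unitBallEquiv E₁ ((absoluteGaloisGroup.toAlgEquiv F σ₀).restrictNormal E₁) : unitBall E₁ →+* unitBall E₁) _))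
  rw [map_inclUnitBall_map_unitBallEquiv_restrictNormal h σ₀]
  rfl

/-- ★ **`r_{ιβ} = ι(r_β)`**: the coordinates of Theorem I.3.7 commute with base change of the unramified base.
[cite: deShalit1987, Ch. I §3.7; Ch. III §1.3] -/
theorem relUnitCoordTwo_baseChange (u : (LTCoeff F)ˣ) (hu : LTCoeff.of F π = residueFieldCard F * u) (β : RelNormCoherentUnits hπ E₁) :
    relUnitCoordTwo hπ E₂ hq hE₂ hσ₀ u hu (β.baseChange hπ hq h hE₂ hσ₀) =
      PowerSeries.map (inclUnitBall (F := F) h : unitBall E₁ →+* unitBall E₂) (relUnitCoordTwo hπ E₁ hq (h.trans hE₂) hσ₀ u hu β) := by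
  symm
  refine eq_relUnitCoordTwo hπ E₂ hq hE₂ hσ₀ u hu _ ?_
  have hcu : (inclUnitBall (F := F) h : unitBall E₁ →+* unitBall E₂) (algebraMap (LTCoeff F) (unitBall E₁) (↑u⁻¹ : LTCoeff F)) =
      algebraMap (LTCoeff F) (unitBall E₂) (↑u⁻¹ : LTCoeff F) := (inclUnitBall (F := F) h).commutes _
  rw [relTildeSeries_baseChange, relTildeSeries_eq_relUnitCoordTwo hπ E₁ hq (h.trans hE₂) hσ₀ u hu β,
    map_mul (PowerSeries.map (inclUnitBall (F := F) h : unitBall E₁ →+* unitBall E₂)),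
    map_add (PowerSeries.map (inclUnitBall (F := F) h : unitBall E₁ →+* unitBall E₂)), map_one,
    map_mul (PowerSeries.map (inclUnitBall (F := F) h : unitBall E₁ →+* unitBall E₂)), PowerSeries.map_C, PowerSeries.map_X, hcu,
    ringHom_map_subst_map_ltSer (ψ := (inclUnitBall (F := F) h : unitBall E₁ →+* unitBall E₂)) (inclUnitBall_algebraMap_pi h π)]

end RelativeBaseChangeTwo

end Literature.NumberTheory.GaloisRepresentations
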